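import Summits.ValiantsHypothesis.ValiantsHypothesis.Theorems.KPlusLogSqLawTridiagonalRealStaticPotentialSteps

/-!
# Route «KPlusLogSqLaw», crux `WeakLifting` (stmt-ValiantsHypothesis-19561) — REAL side of the tridiagonal sector:
# the UNIT-COEFFICIENT sub-sector of the α register — RESONANCE LAW (all sizes) and the EXACT rows `U 3 = 1`, `U 4 = 2`

HONEST FRAMING.  Helper theorems (`--supports stmt-ValiantsHypothesis-19561 --as helper`), seat val-sym-lift-p1 (g15), cell `pub-symmetroid`,
2026-08-28; successor of `…TridiagonalRealStaticUnitShadow` (p601719).  The α register is the static DEFINITE symmetric tridiagonal monomial sector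
(continuant currency `StaticTridiagonalRealPotential.pathDet a d b f m`, `0 < a`); its UNIT-COEFFICIENT sub-sector is `a ≡ 1`, `b ≡ 1` (diagonal
`X^{d_t}`, links `X^{f_t}`); `U m` := the largest number of distinct positive determinant zeros there.  Proved here, for ALL exponent data:
* **RESONANCE LAW** (all sizes, `eval_one_unit`, `isRoot_one_unit_iff`): at `x = 1` every unit design of size `m` evaluates to the period-six
  sequence `1, 1, 0, −1, −1, 0`, so `x = 1` is a determinant zero of EVERY unit design of size `m ≡ 2 (mod 3)` and of NO other;
* **`U 3 = 1`** (`card_posRoots_unit_three_le_one`, `exists_unit_three_card_eq_one`) against the register's `B 3 = 2` (lift-p2 g9): the normalised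
  determinant `1 − x^{L₀} − x^{L₁}` (`L_t = 2f_t − d_t − d_{t+1} ∈ ℤ`) is monotone when `L₀L₁ > 0` and zero-free otherwise;
* **`U 4 = 2`** (`card_posRoots_unit_four_le_two`, `card_posRoots_unit_four_sides`, `exists_unit_four_card_eq_two`) against `B 4 = 3`: the
  normalised determinant `(1 − x^{L₀})(1 − x^{L₂}) − x^{L₁}` equals `−1` at `x = 1`, and on EACH SIDE of `1` it is either sign-dominated (no zero)
  or, divided by a suitable power of `x`, a product of strictly monotone positive factors (at most one zero) — `unit_four_aux` on `(1, ∞)`,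
  transported to `(0, 1)` by `x ↦ 1/x` — although Descartes' rule allows four sign changes there (`L₀ < 0 < L₁ < L₀ + L₂ < L₂`).
So with all coefficients `1` exactly one zero is lost at sizes `3` and `4`.  LOCATED beyond (seat memo UNIT-SUBSECTOR-liftp1g15.md, exact Sturm
censuses): `U 5 = 3`, `U 6 = 3`, `U 7 = 4` — not claimed here.  Nothing here is an upper law for the register (α NO MOVER); nothing bears on
`WeakLifting` / `TropicalB` (stmt-19771) in their windows, Conjecture B, the Door-A registers, `MatrixDescartes` (stmt-18050) or VP ≠ VNP.
[this seat; folklore: continuants ↔ matchings of the path, monotonicity of integer powers]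
-/

-- `Summit.ValiantsHypothesis.ValiantsHypothesis.…` repeats a component by the D-0017 layout (single-conjunct summit); the name is mandated.
set_option linter.dupNamespace false
set_option autoImplicit false

namespace Summit.ValiantsHypothesis.ValiantsHypothesis.Theorems.KPlusLogSqLaw
namespace StaticTridiagonalRealUnit

open Polynomial Finset
open Summit.ValiantsHypothesis.ValiantsHypothesis.Theorems.KPlusLogSqLaw.StaticTridiagonalRealPotential
  (pathDet pathDet_zero pathDet_one pathDet_add_two pathDet_two pathDet_three)
open Summit.ValiantsHypothesis.ValiantsHypothesis.Theorems.SymmetroidDescartes (le_card_posRoots_of_alternating)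

variable (d : ℕ → ℕ) (f : ℕ → ℕ)

/-! ### 1. The resonance law: the value at `x = 1` of every unit design (all sizes) -/

/-- At `x = 1` the three-term recurrence of a unit design forgets the exponents: `D_{n+2}(1) = D_{n+1}(1) − D_n(1)`. [folklore: continuants] -/
theorem eval_one_unit_add_two (n : ℕ) :
    (pathDet (fun _ => (1 : ℝ)) d (fun _ => (1 : ℝ)) f (n + 2)).eval 1 =
      (pathDet (fun _ => (1 : ℝ)) d (fun _ => (1 : ℝ)) f (n + 1)).eval 1 -
        (pathDet (fun _ => (1 : ℝ)) d (fun _ => (1 : ℝ)) f n).eval 1 := by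
  rw [pathDet_add_two]
  simp [eval_sub, eval_mul, eval_pow, eval_X]

/-- `D_{n+3}(1) = −D_n(1)` for every unit design. [folklore] -/
theorem eval_one_unit_add_three (n : ℕ) :
    (pathDet (fun _ => (1 : ℝ)) d (fun _ => (1 : ℝ)) f (n + 3)).eval 1 =
      -(pathDet (fun _ => (1 : ℝ)) d (fun _ => (1 : ℝ)) f n).eval 1 := by
  rw [show n + 3 = (n + 1) + 2 from rfl, eval_one_unit_add_two, eval_one_unit_add_two]
  ring

/-- `D_{n+6}(1) = D_n(1)`: the value at the total-resonance point `x = 1` has period six in the size. [folklore] -/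
theorem eval_one_unit_add_six (n : ℕ) :
    (pathDet (fun _ => (1 : ℝ)) d (fun _ => (1 : ℝ)) f (n + 6)).eval 1 =
      (pathDet (fun _ => (1 : ℝ)) d (fun _ => (1 : ℝ)) f n).eval 1 := by
  rw [show n + 6 = (n + 3) + 3 from rfl, eval_one_unit_add_three, eval_one_unit_add_three, neg_neg]

/-- `D₀(1) = 1`. -/
theorem eval_one_unit_zero : (pathDet (fun _ => (1 : ℝ)) d (fun _ => (1 : ℝ)) f 0).eval 1 = 1 := by
  rw [pathDet_zero]; simp

/-- `D₁(1) = 1`. -/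
theorem eval_one_unit_one : (pathDet (fun _ => (1 : ℝ)) d (fun _ => (1 : ℝ)) f 1).eval 1 = 1 := by
  rw [pathDet_one]; simp

/-- `D₂(1) = 0`: a unit `2 × 2` design `X^{d₀+d₁} − X^{2f₀}` always vanishes at `1`. -/
theorem eval_one_unit_two : (pathDet (fun _ => (1 : ℝ)) d (fun _ => (1 : ℝ)) f 2).eval 1 = 0 := by
  have h := eval_one_unit_add_two d f 0
  rw [zero_add] at h
  rw [h, eval_one_unit_one, eval_one_unit_zero, sub_self]

/-- **RESONANCE LAW (all sizes)**: for EVERY unit-coefficient static symmetric tridiagonal design of size `m` (any exponents) the determinant at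
`x = 1` is `1, 1, 0, −1, −1, 0` according to `m mod 6` — the characteristic value of the unweighted path at `1` (all Leibniz terms tie at the
total-resonance point). [this file; folklore: matchings of the path] -/
theorem eval_one_unit (m : ℕ) :
    (pathDet (fun _ => (1 : ℝ)) d (fun _ => (1 : ℝ)) f m).eval 1 =
      if m % 6 = 0 ∨ m % 6 = 1 then 1 else if m % 6 = 2 ∨ m % 6 = 5 then 0 else -1 := by
  induction m using Nat.strong_induction_on with
  | _ m ih =>
    rcases Nat.lt_or_ge m 6 with hm | hm
    · have h3 := eval_one_unit_add_three d f 0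
      have h4 := eval_one_unit_add_three d f 1
      have h5 := eval_one_unit_add_three d f 2
      rw [zero_add] at h3
      interval_cases m
      · rw [eval_one_unit_zero]; norm_num
      · rw [eval_one_unit_one]; norm_num
      · rw [eval_one_unit_two]; norm_num
      · rw [h3, eval_one_unit_zero]; norm_num
      · rw [h4, eval_one_unit_one]; norm_num
      · rw [h5, eval_one_unit_two]; norm_num
    · obtain ⟨k, rfl⟩ : ∃ k, m = k + 6 := ⟨m - 6, by omega⟩
      rw [eval_one_unit_add_six, ih k (by omega)]
      simp only [Nat.add_mod_right]

/-- **`x = 1` is a determinant zero of a unit design iff its size is `≡ 2 (mod 3)`** (sizes `2, 5, 8, …`: always; all other sizes: never).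
[this file] -/
theorem isRoot_one_unit_iff (m : ℕ) :
    (pathDet (fun _ => (1 : ℝ)) d (fun _ => (1 : ℝ)) f m).IsRoot 1 ↔ m % 3 = 2 := by
  rw [IsRoot, eval_one_unit]
  split_ifs with h1 h2
  · simp only [one_ne_zero, false_iff]; omega
  · simp only [true_iff]; omega
  · simp only [neg_eq_zero, one_ne_zero, false_iff]; omega

/-! ### 2. Integer powers: the monotonicity toolkit (no calculus) -/

/-- `x ^ p = x ^ E · x ^ L` for naturals `p, E` and the integer `L = p − E`. -/
theorem pow_eq_pow_mul_zpow {x : ℝ} (hx : x ≠ 0) {p E : ℕ} {L : ℤ} (h : (p : ℤ) = E + L) :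
    x ^ p = x ^ E * x ^ L := by
  rw [← zpow_natCast, h, zpow_add₀ hx, zpow_natCast]

/-- a negative integer power is strictly decreasing on `(0, ∞)`. -/
theorem zpow_lt_zpow_left_of_neg {L : ℤ} (hL : L < 0) {x y : ℝ} (hx : 0 < x) (hxy : x < y) : y ^ L < x ^ L := by
  have h := zpow_lt_zpow_left₀ (neg_pos.2 hL) hx.le hxy
  rw [zpow_neg, zpow_neg] at h
  exact (inv_lt_inv₀ (zpow_pos hx _) (zpow_pos (hx.trans hxy) _)).1 h

/-- the factor `(x^L − 1) · x^{−p}` is strictly increasing on `(1, ∞)` whenever `0 < L` and `p ≤ L`. -/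
theorem factor_strictMono {L p : ℤ} (hL : 0 < L) (hp : p ≤ L) {x y : ℝ} (hx : 1 < x) (hxy : x < y) :
    (x ^ L - 1) * x ^ (-p) < (y ^ L - 1) * y ^ (-p) := by
  have hx0 : 0 < x := one_pos.trans hx
  have hy0 : 0 < y := hx0.trans hxy
  rcases le_or_gt p 0 with hp0 | hp0
  · -- `x^{−p}` is nondecreasing, `x^L − 1` strictly increasing and positive at `y`
    have h1 : x ^ L - 1 < y ^ L - 1 := sub_lt_sub_right (zpow_lt_zpow_left₀ hL hx0.le hxy) 1
    have h2 : x ^ (-p) ≤ y ^ (-p) := zpow_le_zpow_left₀ (by omega) hx0.le hxy.le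
    have h3 : 0 < x ^ (-p) := zpow_pos hx0 _
    have h4 : 0 ≤ y ^ L - 1 := sub_nonneg.2 (one_le_zpow₀ (hx.trans hxy).le hL.le)
    exact mul_lt_mul h1 h2 h3 h4
  · -- `0 < p ≤ L`: write the factor as `x^{L−p} − x^{−p}`, nondecreasing minus strictly decreasing
    have ex : ∀ z : ℝ, 0 < z → (z ^ L - 1) * z ^ (-p) = z ^ (L - p) - z ^ (-p) := by
      intro z hz
      rw [sub_mul, one_mul, sub_eq_add_neg L p, zpow_add₀ hz.ne']
    rw [ex x hx0, ex y hy0]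
    have h1 : x ^ (L - p) ≤ y ^ (L - p) := zpow_le_zpow_left₀ (by omega) hx0.le hxy.le
    have h2 : y ^ (-p) < x ^ (-p) := zpow_lt_zpow_left_of_neg (by omega) hx0 hxy
    linarith

/-! ### 3. `U 3 = 1` -/

/-- the unit `3 × 3` determinant: `x^{d₂+d₁+d₀} − x^{d₂+2f₀} − x^{2f₁+d₀}`. [folklore] -/
theorem eval_unit_three (x : ℝ) :
    (pathDet (fun _ => (1 : ℝ)) d (fun _ => (1 : ℝ)) f 3).eval x =
      x ^ (d 2 + (d 1 + d 0)) - x ^ (d 2 + 2 * f 0) - x ^ (2 * f 1 + d 0) := by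
  rw [pathDet_three]
  simp [eval_add, eval_pow, eval_X]
  ring

/-- normalised form at `x ≠ 0`: `D₃(x) = x^{E} · (1 − x^{L₀} − x^{L₁})`, `L₀ = 2f₀ − d₀ − d₁`, `L₁ = 2f₁ − d₁ − d₂`. -/
theorem eval_unit_three_eq (x : ℝ) (hx : x ≠ 0) :
    (pathDet (fun _ => (1 : ℝ)) d (fun _ => (1 : ℝ)) f 3).eval x =
      x ^ (d 2 + (d 1 + d 0)) *
        (1 - x ^ ((2 * f 0 : ℤ) - d 0 - d 1) - x ^ ((2 * f 1 : ℤ) - d 1 - d 2)) := by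
  rw [eval_unit_three,
    pow_eq_pow_mul_zpow hx (p := d 2 + 2 * f 0) (E := d 2 + (d 1 + d 0)) (L := (2 * f 0 : ℤ) - d 0 - d 1)
      (by push_cast; ring),
    pow_eq_pow_mul_zpow hx (p := 2 * f 1 + d 0) (E := d 2 + (d 1 + d 0)) (L := (2 * f 1 : ℤ) - d 1 - d 2)
      (by push_cast; ring)]
  ring

/-- the trinomial mechanism: `x^A + x^B = 1` has at most one positive solution (monotone when `AB > 0`; when the exponents have weakly
opposite signs one of the two powers is `≥ 1` on each side of `x = 1`, so there is no solution at all). -/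
theorem unit_three_aux (A B : ℤ) {x y : ℝ} (hx : 0 < x) (hxy : x < y)
    (hxr : x ^ A + x ^ B = 1) (hyr : y ^ A + y ^ B = 1) : False := by
  -- weakly opposite signs: one of the two powers is `≥ 1` on each side of `x = 1`, so there is no solution
  have key : ∀ P Q : ℤ, 0 ≤ P → Q ≤ 0 → 1 < x ^ P + x ^ Q := by
    intro P Q hP hQ
    rcases le_or_gt 1 x with hx1 | hx1
    · linarith [one_le_zpow₀ hx1 hP, zpow_pos hx Q]
    · linarith [one_le_zpow_of_nonpos₀ hx hx1.le hQ, zpow_pos hx P]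
  by_cases h1 : 0 < A ∧ 0 < B
  · -- strictly increasing
    linarith [zpow_lt_zpow_left₀ h1.1 hx.le hxy, zpow_lt_zpow_left₀ h1.2 hx.le hxy]
  by_cases h2 : A < 0 ∧ B < 0
  · -- strictly decreasing
    linarith [zpow_lt_zpow_left_of_neg h2.1 hx hxy, zpow_lt_zpow_left_of_neg h2.2 hx hxy]
  have h3 : (0 ≤ A ∧ B ≤ 0) ∨ (0 ≤ B ∧ A ≤ 0) := by omega
  rcases h3 with ⟨hA, hB⟩ | ⟨hB, hA⟩
  · linarith [key A B hA hB]
  · linarith [key B A hB hA]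

/-- at a positive zero of a unit `3 × 3` design, `x^{L₀} + x^{L₁} = 1`. -/
theorem unit_three_root_eq {x : ℝ} (hx : 0 < x)
    (h : (pathDet (fun _ => (1 : ℝ)) d (fun _ => (1 : ℝ)) f 3).eval x = 0) :
    x ^ ((2 * f 0 : ℤ) - d 0 - d 1) + x ^ ((2 * f 1 : ℤ) - d 1 - d 2) = 1 := by
  rw [eval_unit_three_eq d f x hx.ne'] at h
  rcases mul_eq_zero.1 h with h | h
  · exact absurd h (pow_ne_zero _ hx.ne')
  · linarith

/-- **`U 3 ≤ 1` (kernel, all exponents)**: a unit-coefficient static symmetric tridiagonal `3 × 3` design has at most ONE distinct positive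
determinant zero — against `B 3 = 2` for the register with free positive coefficients. [this file] -/
theorem card_posRoots_unit_three_le_one :
    ((pathDet (fun _ => (1 : ℝ)) d (fun _ => (1 : ℝ)) f 3).roots.toFinset.filter (fun x => 0 < x)).card ≤ 1 := by
  refine Finset.card_le_one.2 fun x hx y hy => ?_
  simp only [Finset.mem_filter, Multiset.mem_toFinset, mem_roots', IsRoot.def] at hx hy
  by_contra hne
  rcases lt_or_gt_of_ne hne with h | h
  · exact unit_three_aux _ _ hx.2 h (unit_three_root_eq d f hx.2 hx.1.2) (unit_three_root_eq d f hy.2 hy.1.2)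
  · exact unit_three_aux _ _ hy.2 h (unit_three_root_eq d f hy.2 hy.1.2) (unit_three_root_eq d f hx.2 hx.1.2)

/-- **`U 3 ≥ 1`**: the unit design with diagonal `(1, 1, 1)` and links `(X, X)` has determinant `1 − 2X²` (a zero between `1/2` and `1`). -/
theorem exists_unit_three_card_eq_one :
    ∃ d f : ℕ → ℕ, ((pathDet (fun _ => (1 : ℝ)) d (fun _ => (1 : ℝ)) f 3).roots.toFinset.filter (fun x => 0 < x)).card = 1 := by
  refine ⟨fun _ => 0, fun _ => 1, le_antisymm (card_posRoots_unit_three_le_one _ _) ?_⟩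
  refine le_card_posRoots_of_alternating _ 1 (![1 / 2, 1] : Fin 2 → ℝ) ?_ ?_ ?_
  · refine Fin.strictMono_iff_lt_succ.2 fun j => ?_
    fin_cases j; simp; norm_num
  · intro j; fin_cases j <;> simp
  · intro j; fin_cases j
    simp [eval_unit_three]
    norm_num

/-! ### 4. `U 4 = 2` -/

/-- the unit `4 × 4` determinant: `x^{d₃+d₂+d₁+d₀} − x^{d₃+d₂+2f₀} − x^{d₃+2f₁+d₀} − x^{2f₂+d₁+d₀} + x^{2f₂+2f₀}` (the five matchings of the path
on four vertices). [folklore] -/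
theorem eval_unit_four (x : ℝ) :
    (pathDet (fun _ => (1 : ℝ)) d (fun _ => (1 : ℝ)) f 4).eval x =
      x ^ (d 3 + (d 2 + (d 1 + d 0))) - x ^ (d 3 + (d 2 + 2 * f 0)) - x ^ (d 3 + (2 * f 1 + d 0)) -
        x ^ (2 * f 2 + (d 1 + d 0)) + x ^ (2 * f 2 + 2 * f 0) := by
  rw [show (4 : ℕ) = 2 + 2 from rfl, pathDet_add_two, pathDet_three, pathDet_two]
  simp [eval_add, eval_sub, eval_mul, eval_pow, eval_X]
  ring

/-- normalised form at `x ≠ 0`: `D₄(x) = x^{E} · ((1 − x^{L₀})(1 − x^{L₂}) − x^{L₁})` with `L_t = 2f_t − d_t − d_{t+1}`. -/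
theorem eval_unit_four_eq (x : ℝ) (hx : x ≠ 0) :
    (pathDet (fun _ => (1 : ℝ)) d (fun _ => (1 : ℝ)) f 4).eval x =
      x ^ (d 3 + (d 2 + (d 1 + d 0))) *
        ((1 - x ^ ((2 * f 0 : ℤ) - d 0 - d 1)) * (1 - x ^ ((2 * f 2 : ℤ) - d 2 - d 3)) -
          x ^ ((2 * f 1 : ℤ) - d 1 - d 2)) := by
  have e1 := pow_eq_pow_mul_zpow hx (p := d 3 + (d 2 + 2 * f 0)) (E := d 3 + (d 2 + (d 1 + d 0)))
    (L := (2 * f 0 : ℤ) - d 0 - d 1) (by push_cast; ring)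
  have e2 := pow_eq_pow_mul_zpow hx (p := d 3 + (2 * f 1 + d 0)) (E := d 3 + (d 2 + (d 1 + d 0)))
    (L := (2 * f 1 : ℤ) - d 1 - d 2) (by push_cast; ring)
  have e3 := pow_eq_pow_mul_zpow hx (p := 2 * f 2 + (d 1 + d 0)) (E := d 3 + (d 2 + (d 1 + d 0)))
    (L := (2 * f 2 : ℤ) - d 2 - d 3) (by push_cast; ring)
  have e4 := pow_eq_pow_mul_zpow hx (p := 2 * f 2 + 2 * f 0) (E := d 3 + (d 2 + (d 1 + d 0)))
    (L := ((2 * f 0 : ℤ) - d 0 - d 1) + ((2 * f 2 : ℤ) - d 2 - d 3)) (by push_cast; ring)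
  rw [eval_unit_four, e1, e2, e3, e4, zpow_add₀ hx]
  ring

/-- **the `4 × 4` mechanism on `(1, ∞)`**: `(1 − x^{L₀})(1 − x^{L₂}) = x^{L₁}` has at most one solution `x > 1` (`L₀ = 0` or mixed signs:
left `≤ 0`; both positive: left `< x^{L₀+L₂} ≤` right when `L₁ ≥ L₀ + L₂`, else `(x^{L₀} − 1)x^{−p} · (x^{L₂} − 1)x^{−q} = 1` with `p + q = L₁`,
`p ≤ L₀`, `q ≤ L₂` is strictly increasing; both negative: left `< 1 ≤` right when `L₁ ≥ 0`, else `(1 − x^{L₀})(1 − x^{L₂})x^{−L₁} = 1` is strictly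
increasing). [this file] -/
theorem unit_four_aux (L₀ L₁ L₂ : ℤ) {x y : ℝ} (hx : 1 < x) (hxy : x < y)
    (hxr : (1 - x ^ L₀) * (1 - x ^ L₂) = x ^ L₁) (hyr : (1 - y ^ L₀) * (1 - y ^ L₂) = y ^ L₁) : False := by
  have hx0 : 0 < x := one_pos.trans hx
  have hy : 1 < y := hx.trans hxy
  have hy0 : 0 < y := hx0.trans hxy
  -- mixed (weak) signs: the left side is `≤ 0 <` the right side
  have mixed : ∀ P Q : ℤ, 0 ≤ P → Q ≤ 0 → (1 - x ^ P) * (1 - x ^ Q) ≠ x ^ L₁ := by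
    intro P Q hP hQ h
    have h1 : 1 - x ^ P ≤ 0 := sub_nonpos.2 (one_le_zpow₀ hx.le hP)
    have h2 : 0 ≤ 1 - x ^ Q := sub_nonneg.2 (zpow_le_one_of_nonpos₀ hx.le hQ)
    have h3 : (1 - x ^ P) * (1 - x ^ Q) ≤ 0 := mul_nonpos_of_nonpos_of_nonneg h1 h2
    linarith [zpow_pos hx0 L₁]
  rcases lt_trichotomy L₀ 0 with hL0 | hL0 | hL0
  · rcases lt_or_ge L₂ 0 with hL2 | hL2
    · -- both negative
      rcases lt_or_ge L₁ 0 with hL1 | hL1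
      · -- strictly increasing product `(1 − x^{L₀})(1 − x^{L₂}) x^{−L₁} = 1`
        have ex : ∀ z : ℝ, 0 < z → (1 - z ^ L₀) * (1 - z ^ L₂) = z ^ L₁ →
            (1 - z ^ L₀) * (1 - z ^ L₂) * z ^ (-L₁) = 1 := by
          intro z hz h
          rw [h, ← zpow_add₀ hz.ne', add_neg_cancel, zpow_zero]
        have a1 : 1 - x ^ L₀ < 1 - y ^ L₀ := by linarith [zpow_lt_zpow_left_of_neg hL0 hx0 hxy]
        have a2 : 1 - x ^ L₂ < 1 - y ^ L₂ := by linarith [zpow_lt_zpow_left_of_neg hL2 hx0 hxy]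
        have p1 : 0 < 1 - x ^ L₀ := sub_pos.2 (zpow_lt_one_of_neg₀ hx hL0)
        have p2 : 0 < 1 - x ^ L₂ := sub_pos.2 (zpow_lt_one_of_neg₀ hx hL2)
        have m2 : (1 - x ^ L₀) * (1 - x ^ L₂) * x ^ (-L₁) < (1 - y ^ L₀) * (1 - y ^ L₂) * y ^ (-L₁) :=
          mul_lt_mul'' (mul_lt_mul'' a1 a2 p1.le p2.le) (zpow_lt_zpow_left₀ (by omega) hx0.le hxy)
            (mul_pos p1 p2).le (zpow_pos hx0 _).le
        rw [ex x hx0 hxr, ex y hy0 hyr] at m2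
        exact lt_irrefl _ m2
      · -- `L₁ ≥ 0`: left `< 1 ≤` right
        have h1 : (1 - x ^ L₀) * (1 - x ^ L₂) < 1 :=
          mul_lt_one_of_nonneg_of_lt_one_left (sub_pos.2 (zpow_lt_one_of_neg₀ hx hL0)).le
            (by linarith [zpow_pos hx0 L₀]) (by linarith [zpow_pos hx0 L₂])
        linarith [one_le_zpow₀ hx.le hL1]
    · exact mixed L₂ L₀ hL2 hL0.le (by rw [mul_comm]; exact hxr)
  · -- `L₀ = 0`: the left side vanishes, the right side is positive
    rw [hL0, zpow_zero, sub_self, zero_mul] at hxr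
    linarith [zpow_pos hx0 L₁]
  · rcases le_or_gt L₂ 0 with hL2 | hL2
    · exact mixed L₀ L₂ hL0.le hL2 hxr
    · -- both positive
      rcases le_or_gt (L₀ + L₂) L₁ with hL1 | hL1
      · -- `L₁ ≥ L₀ + L₂`: left `< x^{L₀+L₂} ≤ x^{L₁}`
        have h1 : (x ^ L₀ - 1) * (x ^ L₂ - 1) < x ^ L₀ * x ^ L₂ :=
          mul_lt_mul'' (sub_lt_self _ one_pos) (sub_lt_self _ one_pos)
            (sub_pos.2 (one_lt_zpow₀ hx hL0)).le (sub_pos.2 (one_lt_zpow₀ hx hL2)).le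
        have h2 : x ^ L₀ * x ^ L₂ ≤ x ^ L₁ := by
          rw [← zpow_add₀ hx0.ne']; exact zpow_le_zpow_right₀ hx.le hL1
        have h3 : (1 - x ^ L₀) * (1 - x ^ L₂) = (x ^ L₀ - 1) * (x ^ L₂ - 1) := by ring
        linarith
      · -- `L₁ < L₀ + L₂`: split `L₁ = p + q`, `p ≤ L₀`, `q ≤ L₂`; strictly increasing product
        set p : ℤ := min L₁ L₀ with hp
        set q : ℤ := L₁ - p with hq
        have hpL : p ≤ L₀ := min_le_right _ _
        have hqL : q ≤ L₂ := by
          rcases le_or_gt L₁ L₀ with h | h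
          · rw [hq, hp, min_eq_left h]; omega
          · rw [hq, hp, min_eq_right h.le]; omega
        have ex : ∀ z : ℝ, 0 < z → (1 - z ^ L₀) * (1 - z ^ L₂) = z ^ L₁ →
            ((z ^ L₀ - 1) * z ^ (-p)) * ((z ^ L₂ - 1) * z ^ (-q)) = 1 := by
          intro z hz h
          have h' : (z ^ L₀ - 1) * (z ^ L₂ - 1) = z ^ L₁ := by rw [← h]; ring
          calc ((z ^ L₀ - 1) * z ^ (-p)) * ((z ^ L₂ - 1) * z ^ (-q))
              = ((z ^ L₀ - 1) * (z ^ L₂ - 1)) * (z ^ (-p) * z ^ (-q)) := by ring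
            _ = z ^ L₁ * z ^ (-p + -q) := by rw [h', zpow_add₀ hz.ne']
            _ = 1 := by rw [← zpow_add₀ hz.ne', show L₁ + (-p + -q) = 0 by omega, zpow_zero]
        have m1 := mul_lt_mul'' (factor_strictMono hL0 hpL hx hxy) (factor_strictMono hL2 hqL hx hxy)
          (mul_pos (sub_pos.2 (one_lt_zpow₀ hx hL0)) (zpow_pos hx0 _)).le
          (mul_pos (sub_pos.2 (one_lt_zpow₀ hx hL2)) (zpow_pos hx0 _)).le
        rw [ex x hx0 hxr, ex y hy0 hyr] at m1
        exact lt_irrefl _ m1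

/-- the same on `(0, 1)`, transported by `x ↦ x⁻¹` (which negates the three exponents). [this file] -/
theorem unit_four_aux_lt_one (L₀ L₁ L₂ : ℤ) {x y : ℝ} (hx : 0 < x) (hxy : x < y) (hy : y < 1)
    (hxr : (1 - x ^ L₀) * (1 - x ^ L₂) = x ^ L₁) (hyr : (1 - y ^ L₀) * (1 - y ^ L₂) = y ^ L₁) : False := by
  have hy0 : 0 < y := hx.trans hxy
  have key : ∀ z : ℝ, ∀ L : ℤ, z⁻¹ ^ (-L) = z ^ L := fun z L => by rw [inv_zpow', neg_neg]
  refine unit_four_aux (-L₀) (-L₁) (-L₂) (x := y⁻¹) (y := x⁻¹) ((one_lt_inv₀ hy0).2 hy)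
    ((inv_lt_inv₀ hy0 hx).2 hxy) ?_ ?_
  · rw [key, key, key]; exact hyr
  · rw [key, key, key]; exact hxr

/-- at a positive zero of a unit `4 × 4` design, `(1 − x^{L₀})(1 − x^{L₂}) = x^{L₁}`. -/
theorem unit_four_root_eq {x : ℝ} (hx : 0 < x)
    (h : (pathDet (fun _ => (1 : ℝ)) d (fun _ => (1 : ℝ)) f 4).eval x = 0) :
    (1 - x ^ ((2 * f 0 : ℤ) - d 0 - d 1)) * (1 - x ^ ((2 * f 2 : ℤ) - d 2 - d 3)) = x ^ ((2 * f 1 : ℤ) - d 1 - d 2) := by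
  rw [eval_unit_four_eq d f x hx.ne'] at h
  rcases mul_eq_zero.1 h with h | h
  · exact absurd h (pow_ne_zero _ hx.ne')
  · linarith

/-- **`U 4 ≤ 2` (kernel, all exponents), in its sharp one-sided form**: a unit-coefficient static symmetric tridiagonal `4 × 4` design has NO
determinant zero at `x = 1`, at most ONE in `(0, 1)` and at most ONE in `(1, ∞)` — against `B 4 = 3` for the register with free positive
coefficients, and against the four Descartes sign changes the normalised determinant can have. [this file] -/
theorem card_posRoots_unit_four_sides :
    ¬ (pathDet (fun _ => (1 : ℝ)) d (fun _ => (1 : ℝ)) f 4).IsRoot 1 ∧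
    (((pathDet (fun _ => (1 : ℝ)) d (fun _ => (1 : ℝ)) f 4).roots.toFinset.filter (fun x => 0 < x ∧ x < 1)).card ≤ 1) ∧
    (((pathDet (fun _ => (1 : ℝ)) d (fun _ => (1 : ℝ)) f 4).roots.toFinset.filter (fun x => 1 < x)).card ≤ 1) := by
  refine ⟨fun h => ?_, ?_, ?_⟩
  · rw [isRoot_one_unit_iff] at h; omega
  · refine Finset.card_le_one.2 fun x hx y hy => ?_
    simp only [Finset.mem_filter, Multiset.mem_toFinset, mem_roots', IsRoot.def] at hx hy
    by_contra hne
    rcases lt_or_gt_of_ne hne with h | h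
    · exact unit_four_aux_lt_one _ _ _ hx.2.1 h hy.2.2 (unit_four_root_eq d f hx.2.1 hx.1.2)
        (unit_four_root_eq d f hy.2.1 hy.1.2)
    · exact unit_four_aux_lt_one _ _ _ hy.2.1 h hx.2.2 (unit_four_root_eq d f hy.2.1 hy.1.2)
        (unit_four_root_eq d f hx.2.1 hx.1.2)
  · refine Finset.card_le_one.2 fun x hx y hy => ?_
    simp only [Finset.mem_filter, Multiset.mem_toFinset, mem_roots', IsRoot.def] at hx hy
    by_contra hne
    rcases lt_or_gt_of_ne hne with h | h
    · exact unit_four_aux _ _ _ hx.2 h (unit_four_root_eq d f (one_pos.trans hx.2) hx.1.2)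
        (unit_four_root_eq d f (one_pos.trans hy.2) hy.1.2)
    · exact unit_four_aux _ _ _ hy.2 h (unit_four_root_eq d f (one_pos.trans hy.2) hy.1.2)
        (unit_four_root_eq d f (one_pos.trans hx.2) hx.1.2)

/-- **`U 4 ≤ 2` (kernel, all exponents)**: a unit-coefficient static symmetric tridiagonal `4 × 4` design has at most TWO distinct positive
determinant zeros. [this file] -/
theorem card_posRoots_unit_four_le_two :
    ((pathDet (fun _ => (1 : ℝ)) d (fun _ => (1 : ℝ)) f 4).roots.toFinset.filter (fun x => 0 < x)).card ≤ 2 := by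
  obtain ⟨h1, hlt, hgt⟩ := card_posRoots_unit_four_sides d f
  set S := (pathDet (fun _ => (1 : ℝ)) d (fun _ => (1 : ℝ)) f 4).roots.toFinset with hS
  have hsub : S.filter (fun x => 0 < x) ⊆ S.filter (fun x => 0 < x ∧ x < 1) ∪ S.filter (fun x => 1 < x) := by
    intro x hx
    rw [Finset.mem_filter] at hx
    rw [Finset.mem_union, Finset.mem_filter, Finset.mem_filter]
    rcases lt_trichotomy x 1 with h | rfl | h
    · exact Or.inl ⟨hx.1, hx.2, h⟩
    · rw [hS, Multiset.mem_toFinset, mem_roots'] at hx; exact absurd hx.1.2 h1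
    · exact Or.inr ⟨hx.1, h⟩
  exact (Finset.card_le_card hsub).trans ((Finset.card_union_le _ _).trans (add_le_add hlt hgt))

/-- **`U 4 ≥ 2`**: the unit design with diagonal `(1, 1, 1, 1)` and links `(X, X, X)` has determinant `1 − 3X² + X⁴` (sign changes at
`1/2, 1, 2`). -/
theorem exists_unit_four_card_eq_two :
    ∃ d f : ℕ → ℕ, ((pathDet (fun _ => (1 : ℝ)) d (fun _ => (1 : ℝ)) f 4).roots.toFinset.filter (fun x => 0 < x)).card = 2 := by
  refine ⟨fun _ => 0, fun _ => 1, le_antisymm (card_posRoots_unit_four_le_two _ _) ?_⟩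
  refine le_card_posRoots_of_alternating _ 2 (![1 / 2, 1, 2] : Fin 3 → ℝ) ?_ ?_ ?_
  · refine Fin.strictMono_iff_lt_succ.2 fun j => ?_
    fin_cases j <;> norm_num [Matrix.cons_val_two, Matrix.tail_cons, Matrix.head_cons]
  · intro j; fin_cases j <;> simp
  · intro j; fin_cases j <;> (simp [eval_unit_four]; norm_num)

end StaticTridiagonalRealUnit
end Summit.ValiantsHypothesis.ValiantsHypothesis.Theorems.KPlusLogSqLaw
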